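import Mathlib.Tactic

/-!
# ω-census, family (b3): conjecture C9 on the Frobenius family — the arithmetic core of 'phase arcs with trimmed ends'

HONEST FRAMING (pub-omega census; verbatim): lottery ticket; floor = certified bounds/negative ranges.
Census BOOKKEEPING (conjecture C9 of the cell; pub-omega stpp-1 gen 20).  By `MetacyclicBoxPattern.lean` a `3 × 3` box of
`ℤ/p ⋊_u ℤ/q` is a forbidden-difference graph on `9 × ℤ/p`.  The seat's UNIFORM construction for the Frobenius groups
`ℤ/p ⋊ ℤ/3` (design note HOME/pub-omega-stpp-1-g20/UNIFORM-FROBENIUS-DESIGN.md) takes, in a coordinate `A ∈ [0,p)` of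
`ℤ/p`, unions of the eight PHASE BLOCKS `{A : φ p ≤ 8A < (φ+1) p}` with TRIMMED ends (`φ p + lo ≤ 8A`, `8A + hi < (φ+1)p`),
the phases chosen by a pattern `P_c ⊆ ℤ/8` per column; every forbidden difference `δ` of the box satisfies `8δ = Φ·p + E` with
a phase shift `Φ` and an ERROR `|E| = O(√p)` (lattice approximation of `(α, uα)`), so two cells at difference `δ` have phases
differing by `Φ`, `Φ + 1` or `Φ − 1 (mod 8)` — the last two only inside end zones of width `|E|`, which the trims remove.
This file is the purely arithmetical core of that argument, over `ℤ`, with no group theory: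
`PhaseArcs.no_conflict_core` (offsets form) and `PhaseArcs.no_conflict` (coordinates form): under the main pattern
condition `φ − φ' ≢ Φ (mod 8)` and the two trim conditions for `φ − φ' ≡ Φ ± 1`, no two trimmed-block cells differ by `δ`
modulo `p`.  It is instantiated by the per-class phase patterns (uniform in `p`) and by per-prime certificates alike.
Nothing here is progress on `ω`.
-/

namespace Summit.MatrixMultiplication.OmegaCensus

namespace PhaseArcs

/-- If `m·p = t` with `-2p < t < 2p` (`p > 0`) then `m ∈ {-1, 0, 1}`. [folklore] -/
theorem abs_le_one_of_mul {m p t : ℤ} (hp : 0 < p) (h : m * p = t) (h1 : t < 2 * p) (h2 : -(2 * p) < t) :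
    -1 ≤ m ∧ m ≤ 1 := by
  constructor
  · by_contra hc
    have hc' : m ≤ -2 := by omega
    have : m * p ≤ -2 * p := by nlinarith
    linarith
  · by_contra hc
    have hc' : 2 ≤ m := by omega
    have : 2 * p ≤ m * p := by nlinarith
    linarith

/-- **Core lemma (offsets form).** Two trimmed phase-block cells with offsets `r ∈ [lo, p − hi)`, `r' ∈ [lo', p − hi')` whose
phase data satisfy `m·p = E + r' − r` (`m ≡ φ − φ' − Φ (mod 8)`), under the pattern condition `m ≢ 0 (mod 8)` and the trim
conditions for `m ≡ ±1`, cannot exist when `2|E| < p`. [folklore] -/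
theorem no_conflict_core {p m E r r' lo hi lo' hi' : ℤ} (hp : 0 < p)
    (hr : lo ≤ r) (hr2 : r + hi < p) (hr' : lo' ≤ r') (hr'2 : r' + hi' < p)
    (hlo : 0 ≤ lo) (hhi : 0 ≤ hi) (hlo' : 0 ≤ lo') (hhi' : 0 ≤ hi')
    (hE : 2 * |E| < p) (hm : m * p = E + r' - r)
    (h0 : m % 8 ≠ 0)
    (hplus : (m - 1) % 8 = 0 → 0 < E → E ≤ hi' ∨ E ≤ lo)
    (hminus : (m + 1) % 8 = 0 → E < 0 → -E ≤ lo' ∨ -E ≤ hi) : False := by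
  have hEle : |E| = E ∨ |E| = -E := abs_choice E
  have hEnn : 0 ≤ |E| := abs_nonneg E
  have hb := abs_le_one_of_mul hp hm (by rcases hEle with h | h <;> linarith) (by rcases hEle with h | h <;> linarith)
  obtain ⟨hb1, hb2⟩ := hb
  interval_cases m
  · -- m = -1 : -p = E + r' - r
    have hE0 : E < 0 := by linarith
    rcases hminus (by decide) hE0 with h | h <;> linarith
  · exact h0 (by decide)
  · -- m = 1 : p = E + r' - r
    have hE0 : 0 < E := by linarith
    rcases hplus (by decide) hE0 with h | h <;> linarith

/-- **Coordinates form.** Cells `A, A'` (`0 ≤ A, A' < p` not even needed) in trimmed phase blocks `φ, φ'`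
(`φ p + lo ≤ 8A`, `8A + hi < (φ+1) p`, likewise primed), a difference `A − A' = δ + j p` (`A − A' ≡ δ (mod p)`) with
`8δ = Φ p + E`, `2|E| < p`: impossible under the pattern condition `φ − φ' − Φ ≢ 0 (mod 8)` and the trim conditions
`φ − φ' − Φ ≡ 1 ⇒ (E > 0 ⇒ hi' ≥ E ∨ lo ≥ E)`, `φ − φ' − Φ ≡ −1 ⇒ (E < 0 ⇒ lo' ≥ −E ∨ hi ≥ −E)`. [folklore] -/
theorem no_conflict {p φ φ' Φ j E lo hi lo' hi' A A' δ : ℤ} (hp : 0 < p)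
    (hA : φ * p + lo ≤ 8 * A) (hA2 : 8 * A + hi < (φ + 1) * p)
    (hA' : φ' * p + lo' ≤ 8 * A') (hA'2 : 8 * A' + hi' < (φ' + 1) * p)
    (hlo : 0 ≤ lo) (hhi : 0 ≤ hi) (hlo' : 0 ≤ lo') (hhi' : 0 ≤ hi')
    (hE : 2 * |E| < p) (hδ : 8 * δ = Φ * p + E) (hdiff : A - A' = δ + j * p)
    (h0 : (φ - φ' - Φ) % 8 ≠ 0)
    (hplus : (φ - φ' - Φ - 1) % 8 = 0 → 0 < E → E ≤ hi' ∨ E ≤ lo)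
    (hminus : (φ - φ' - Φ + 1) % 8 = 0 → E < 0 → -E ≤ lo' ∨ -E ≤ hi) : False := by
  set r := 8 * A - φ * p with hr_def
  set r' := 8 * A' - φ' * p with hr'_def
  have hm : (φ - φ' - Φ - 8 * j) * p = E + r' - r := by
    rw [hr_def, hr'_def]; linear_combination hδ + 8 * hdiff
  refine no_conflict_core (m := φ - φ' - Φ - 8 * j) hp (by linarith) (by linarith) (by linarith) (by linarith)
    hlo hhi hlo' hhi' hE hm ?_ ?_ ?_
  · intro h; apply h0; omega
  · intro h; exact hplus (by omega)
  · intro h; exact hminus (by omega)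

end PhaseArcs

end Summit.MatrixMultiplication.OmegaCensus
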